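import Summits.ResolutionOfSingularities.ResolutionOfSingularities.Theorems.PurelyInseparableDim4AtlasCertTwoCharts
import Summits.ResolutionOfSingularities.ResolutionOfSingularities.Theorems.PurelyInseparableDim4AtlasNodes
import HarnessLib

/-!
# Purely inseparable four-folds: the DEPTH-TWO ESCAPING CERTIFICATE of the v4 atlas chain — a marked resolution of
# `z^p + x₁^{3p} x₄ + x₁^{p−1} x₂ x₃^{2p} + x₁ x₂^p x₃^{p−1} + x₂^{2p+1}` (`p ≥ 3`) through an escaping child carrying an escaping
# grandchild (brick S3 (c) v4, tranche 1, brick A6b; cell `res-dim4-pi`)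

[OURS · counted 0] (D-0157 DOOR 2; host item stmt-ResolutionOfSingularities-16155, helper; crit-3 rider S-62-2, optional clause «a
depth-2 escaping entry in its forest»). Nothing here proves resolution of singularities in dimension ≥ 4 / characteristic `p`.
The v4 plan has FIVE readings: the root host `r₀ = (⟨F,0,∅⟩, {0,1}, ∅, ∅)` with ONE escaping entry `e₀ = (0, 0, {0,2})`; the child's
main reading `r₁` (chart `x₁`, state `F₀`, centre `{0,2}`, bundle direction `1`) with ONE escaping entry `e₁ = (0, 0, {0,1})`
(FIBREWISE: the bundle direction `1` lies in the new centre) and the child's extra reading `r₂` (chart `x₂`, state `F₁`, centre `{1,2}`,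
deferring `y₁ = 0`, no entries); the grandchild's main reading `r₁₁` (state `F₀₀`, centre `{0,1}`, bundle direction `2`) and extra
reading `r₁₂` (state `F₀₂`, centre `{1,2}`, deferring `y₁ = 0`), both without entries — every later chart is dead. `BlockA` at the five
readings (A6b-computations / A6b-charts), accessibility, the root cover `x₁ = x₂ = 0` and `exists_isMarkedResolution_atlas_root` give
the marked resolution: the chain A1–A5 run through TWO successive escaping levels.

* **`exists_isMarkedResolution_bcert`**. AI-produced formalisation, weaker than expert review.
bears_on: LADDER-RESOLUTION:D157-DOOR2 (res-dim4-pi · S3 (c) v4 A6b certificate).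
-/

set_option linter.dupNamespace false -- D-0017: single-problem summit path `Summit.<S>.<S>.…` by design

noncomputable section

open MvPolynomial Finset CategoryTheory AlgebraicGeometry Opposite TopologicalSpace
open AlgebraicGeometry.Scheme.IdealSheafData (ofIdealTop vanishingIdeal)

namespace Summit.ResolutionOfSingularities.ResolutionOfSingularities.Theorems.PIDim4

open Literature.AlgebraicGeometry.Resolution
open Literature.AlgebraicGeometry.Resolution.Hauser2010
open Literature.AlgebraicGeometry.Resolution.AffinePointBlowup (P A γ coord Wtop ξ)

namespace Equimultiple

section BCertInstance

variable {K : Type} [Field K] {p : ℕ} [hp : Fact p.Prime] [CharP K p]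

/-- **THE DEPTH-TWO ESCAPING CERTIFICATE (v4 A6b).** See the module docstring. [cite: BierstoneGrigorievMilmanWlodarczyk2011,
Def. 3.1.3; §4 Step 2b] [cite: Hauser2010, §F (equiconstant points)] -/
theorem exists_isMarkedResolution_bcert [IsAlgClosed K] [DecidableEq K] (hp3 : 3 ≤ p) :
    ∃ (X' : Scheme.{0}) (ρ : X' ⟶ P 4 K) (M' : MarkedIdeal X'),
      IsMarkedResolution (⟨hypSheaf p (X 0 ^ (3 * p) * X 3 + X 0 ^ (p - 1) * X 1 * X 2 ^ (2 * p) + X 0 * X 1 ^ p * X 2 ^ (p - 1) +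
        X 1 ^ (2 * p + 1) : MvPolynomial (Fin 4) K), [], p⟩ : MarkedIdeal (P 4 K)) ρ M' := by
  classical
  set F : MvPolynomial (Fin 4) K := X 0 ^ (3 * p) * X 3 + X 0 ^ (p - 1) * X 1 * X 2 ^ (2 * p) + X 0 * X 1 ^ p * X 2 ^ (p - 1) +
    X 1 ^ (2 * p + 1) with hFdef
  -- centres, entries, tables
  set S₀ : Finset (Fin 4) := {0, 1} with hS₀
  set S₁ : Finset (Fin 4) := {0, 2} with hS₁
  have h01 : S₀ ≠ S₁ := by rw [hS₀, hS₁]; decide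
  have hT₂ : insert (1 : Fin 4) (S₁.erase 0) = ({1, 2} : Finset (Fin 4)) := by rw [hS₁]; decide
  have hT₁₂ : insert (2 : Fin 4) (S₀.erase 0) = ({1, 2} : Finset (Fin 4)) := by rw [hS₀]; decide
  have h21 : insert (1 : Fin 4) (S₁.erase 0) ≠ S₁ := by rw [hT₂, hS₁]; decide
  have h20 : insert (1 : Fin 4) (S₁.erase 0) ≠ S₀ := by rw [hT₂, hS₀]; decide
  have h121 : insert (2 : Fin 4) (S₀.erase 0) ≠ S₁ := by rw [hT₁₂, hS₁]; decide
  have h120 : insert (2 : Fin 4) (S₀.erase 0) ≠ S₀ := by rw [hT₁₂, hS₀]; decide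
  have hdiff : S₀ \ S₁ = ({1} : Finset (Fin 4)) := by rw [hS₀, hS₁]; decide
  have hdiff' : S₁ \ S₀ = ({2} : Finset (Fin 4)) := by rw [hS₀, hS₁]; decide
  have hD : S₁ \ S₀ ≠ (∅ : Finset (Fin 4)) := by rw [hdiff']; decide
  set e₀ : Fin 4 × (Fin 4 → K) × Finset (Fin 4) := ((0 : Fin 4), (0 : Fin 4 → K), S₁) with he₀
  set e₁ : Fin 4 × (Fin 4 → K) × Finset (Fin 4) := ((0 : Fin 4), (0 : Fin 4 → K), S₀) with he₁
  let plan : AReading K → Finset (Fin 4 × (Fin 4 → K) × Finset (Fin 4)) := fun r =>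
    if r.2.1 = S₁ then {e₁} else if r.2.1 = S₀ ∧ r.2.2.2 = ∅ then {e₀} else ∅
  let leaves : AReading K → Finset (Fin 4 × (Fin 4 → K)) := fun _ => ∅
  -- the states and the readings
  set s₀ : State K := ⟨F, 0, ∅⟩ with hs₀
  have hs₀F : s₀.F = X 0 ^ (3 * p) * X 3 + X 0 ^ (p - 1) * X 1 * X 2 ^ (2 * p) + X 0 * X 1 ^ p * X 2 ^ (p - 1) +
      X 1 ^ (2 * p + 1) := rfl
  set r₀ : AReading K := (s₀, S₀, (∅ : Finset (Fin 4 × K)), (∅ : Finset (Fin 4))) with hr₀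
  set r₁ : AReading K := mainReading p r₀ e₀ with hr₁
  set r₂ : AReading K := extraReading p r₀ e₀ 1 with hr₂
  set r₁₁ : AReading K := mainReading p r₁ e₁ with hr₁₁
  set r₁₂ : AReading K := extraReading p r₁ e₁ 2 with hr₁₂
  have hr₁T : r₁.2.1 = S₁ := rfl
  have hr₂T : r₂.2.1 = insert (1 : Fin 4) (S₁.erase 0) := rfl
  have hr₁₁T : r₁₁.2.1 = S₀ := rfl
  have hr₁₂T : r₁₂.2.1 = insert (2 : Fin 4) (S₀.erase 0) := rfl
  have hr₁F : r₁.1.F = C 1 * (X 0 ^ (2 * p) * X 1 ^ 0 * X 2 ^ 0 * X 3 ^ 1) +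
        C 1 * (X 0 ^ 0 * X 1 ^ 1 * X 2 ^ (2 * p) * X 3 ^ 0) +
        C 1 * (X 0 ^ 1 * X 1 ^ p * X 2 ^ (p - 1) * X 3 ^ 0) +
        C 1 * (X 0 ^ (p + 1) * X 1 ^ (2 * p + 1) * X 2 ^ 0 * X 3 ^ 0) := step_S0_bcert s₀ hs₀F
  have hr₂F : r₂.1.F = C 1 * (X 0 ^ (3 * p) * X 1 ^ (2 * p) * X 2 ^ 0 * X 3 ^ 1) +
        C 1 * (X 0 ^ (p - 1) * X 1 ^ 0 * X 2 ^ (2 * p) * X 3 ^ 0) +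
        C 1 * (X 0 ^ 1 * X 1 ^ 1 * X 2 ^ (p - 1) * X 3 ^ 0) +
        C 1 * (X 0 ^ 0 * X 1 ^ (p + 1) * X 2 ^ 0 * X 3 ^ 0) := escState_S1_bcert s₀ hs₀F
  have hr₁₁F : r₁₁.1.F = C 1 * (X 0 ^ p * X 1 ^ 0 * X 2 ^ 0 * X 3 ^ 1) +
        C 1 * (X 0 ^ p * X 1 ^ 1 * X 2 ^ (2 * p) * X 3 ^ 0) +
        C 1 * (X 0 ^ 0 * X 1 ^ p * X 2 ^ (p - 1) * X 3 ^ 0) +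
        C 1 * (X 0 ^ 1 * X 1 ^ (2 * p + 1) * X 2 ^ 0 * X 3 ^ 0) := step_T0_bcert r₁.1 hr₁F
  have hr₁₂F : r₁₂.1.F = C 1 * (X 0 ^ (2 * p) * X 1 ^ 0 * X 2 ^ p * X 3 ^ 1) +
        C 1 * (X 0 ^ 0 * X 1 ^ 1 * X 2 ^ p * X 3 ^ 0) +
        C 1 * (X 0 ^ 1 * X 1 ^ p * X 2 ^ 0 * X 3 ^ 0) +
        C 1 * (X 0 ^ (p + 1) * X 1 ^ (2 * p + 1) * X 2 ^ 1 * X 3 ^ 0) := escState_T2_bcert r₁.1 hr₁F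
  have hplan₀ : plan r₀ = {e₀} := (if_neg h01).trans (if_pos ⟨rfl, rfl⟩)
  have hplan₁ : plan r₁ = {e₁} := if_pos rfl
  have hplan₂ : plan r₂ = ∅ := (if_neg h21).trans (if_neg fun h => h20 h.1)
  have hplan₁₁ : plan r₁₁ = ∅ := (if_neg h01).trans (if_neg fun h => hD h.2)
  have hplan₁₂ : plan r₁₂ = ∅ := (if_neg h121).trans (if_neg fun h => h120 h.1)
  -- the edges
  have hE₀ : ∀ q', AEdge p plan q' r₀ ↔ q' = r₁ ∨ q' = r₂ := by
    intro q'
    constructor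
    · rintro ⟨e, he, h | ⟨l, hl, h⟩⟩
      · rw [hplan₀, Finset.mem_singleton] at he; rw [h, he]; exact Or.inl rfl
      · rw [hplan₀, Finset.mem_singleton] at he
        rw [he] at hl h
        change l ∈ S₀ \ S₁ at hl
        rw [hdiff, Finset.mem_singleton] at hl
        rw [h, hl]; exact Or.inr rfl
    · rintro (rfl | rfl)
      · exact ⟨e₀, by rw [hplan₀]; exact Finset.mem_singleton_self _, Or.inl rfl⟩
      · refine ⟨e₀, by rw [hplan₀]; exact Finset.mem_singleton_self _, Or.inr ⟨1, ?_, rfl⟩⟩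
        change (1 : Fin 4) ∈ S₀ \ S₁
        rw [hdiff]; exact Finset.mem_singleton_self _
  have hE₁ : ∀ q', AEdge p plan q' r₁ ↔ q' = r₁₁ ∨ q' = r₁₂ := by
    intro q'
    constructor
    · rintro ⟨e, he, h | ⟨l, hl, h⟩⟩
      · rw [hplan₁, Finset.mem_singleton] at he; rw [h, he]; exact Or.inl rfl
      · rw [hplan₁, Finset.mem_singleton] at he
        rw [he] at hl h
        change l ∈ S₁ \ S₀ at hl
        rw [hdiff', Finset.mem_singleton] at hl
        rw [h, hl]; exact Or.inr rfl
    · rintro (rfl | rfl)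
      · exact ⟨e₁, by rw [hplan₁]; exact Finset.mem_singleton_self _, Or.inl rfl⟩
      · refine ⟨e₁, by rw [hplan₁]; exact Finset.mem_singleton_self _, Or.inr ⟨2, ?_, rfl⟩⟩
        change (2 : Fin 4) ∈ S₁ \ S₀
        rw [hdiff']; exact Finset.mem_singleton_self _
  have hE₂ : ∀ q', ¬ AEdge p plan q' r₂ := by
    rintro q' ⟨e, he, -⟩; rw [hplan₂] at he; exact absurd he (Finset.notMem_empty e)
  have hE₁₁ : ∀ q', ¬ AEdge p plan q' r₁₁ := by
    rintro q' ⟨e, he, -⟩; rw [hplan₁₁] at he; exact absurd he (Finset.notMem_empty e)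
  have hE₁₂ : ∀ q', ¬ AEdge p plan q' r₁₂ := by
    rintro q' ⟨e, he, -⟩; rw [hplan₁₂] at he; exact absurd he (Finset.notMem_empty e)
  have hreach₀ : ∀ q, Relation.ReflTransGen (fun a e : AReading K => AEdge p plan e a) r₀ q →
      q = r₀ ∨ q = r₁ ∨ q = r₂ ∨ q = r₁₁ ∨ q = r₁₂ := by
    intro q hq
    induction hq with
    | refl => exact Or.inl rfl
    | tail _ h ih =>
      rcases ih with rfl | rfl | rfl | rfl | rfl
      · rcases (hE₀ _).mp h with rfl | rfl
        exacts [Or.inr (Or.inl rfl), Or.inr (Or.inr (Or.inl rfl))]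
      · rcases (hE₁ _).mp h with rfl | rfl
        exacts [Or.inr (Or.inr (Or.inr (Or.inl rfl))), Or.inr (Or.inr (Or.inr (Or.inr rfl)))]
      · exact absurd h (hE₂ _)
      · exact absurd h (hE₁₁ _)
      · exact absurd h (hE₁₂ _)
  have hacc₂ : Acc (fun q' q : AReading K => AEdge p plan q' q) r₂ := Acc.intro _ fun q' h => absurd h (hE₂ q')
  have hacc₁₁ : Acc (fun q' q : AReading K => AEdge p plan q' q) r₁₁ := Acc.intro _ fun q' h => absurd h (hE₁₁ q')
  have hacc₁₂ : Acc (fun q' q : AReading K => AEdge p plan q' q) r₁₂ := Acc.intro _ fun q' h => absurd h (hE₁₂ q')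
  have hacc₁ : Acc (fun q' q : AReading K => AEdge p plan q' q) r₁ :=
    Acc.intro _ fun q' h => by rcases (hE₁ q').mp h with rfl | rfl; exacts [hacc₁₁, hacc₁₂]
  have hacc₀ : Acc (fun q' q : AReading K => AEdge p plan q' q) r₀ :=
    Acc.intro _ fun q' h => by rcases (hE₀ q').mp h with rfl | rfl; exacts [hacc₁, hacc₂]
  -- helpers
  have hemp : ∀ {α : Type} (x : α) (P : Prop), x ∈ (∅ : Finset α) → P := fun x P hx => absurd hx (Finset.notMem_empty x)
  have hesc₀ : IsEscaping S₀ e₀ := by change ¬ S₀ ⊆ S₁; rw [hS₀, hS₁]; decide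
  have hesc₁ : IsEscaping S₁ e₁ := by change ¬ S₁ ⊆ S₀; rw [hS₀, hS₁]; decide
  -- the five blocks
  have hblock₂ : BlockA p plan leaves r₂ := by
    refine ⟨fun e he => hemp e _ (by rw [hplan₂] at he; exact he), fun e he => hemp e _ (by rw [hplan₂] at he; exact he),
      fun l hl => hemp l _ hl, fun j' b' hj' hb' _ _ heq => ?_⟩
    exfalso
    rw [hr₂T, hT₂] at hj' heq
    rcases Finset.mem_insert.mp hj' with rfl | hj'
    · exact not_isEquimultiplePoint_R1_bcert r₂.1 hr₂F heq
    · rw [Finset.mem_singleton] at hj'; subst hj'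
      exact not_isEquimultiplePoint_R2_bcert hp3 r₂.1 hr₂F hb' heq
  have hblock₁₁ : BlockA p plan leaves r₁₁ := by
    refine ⟨fun e he => hemp e _ (by rw [hplan₁₁] at he; exact he), fun e he => hemp e _ (by rw [hplan₁₁] at he; exact he),
      fun l hl => hemp l _ hl, fun j' b' hj' hb' _ _ heq => ?_⟩
    exfalso
    rw [hr₁₁T, hS₀] at hj' heq
    rcases Finset.mem_insert.mp hj' with rfl | hj'
    · exact not_isEquimultiplePoint_U0_bcert r₁₁.1 hr₁₁F heq
    · rw [Finset.mem_singleton] at hj'; subst hj'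
      exact not_isEquimultiplePoint_U1_bcert hp3 r₁₁.1 hr₁₁F hb' heq
  have hblock₁₂ : BlockA p plan leaves r₁₂ := by
    refine ⟨fun e he => hemp e _ (by rw [hplan₁₂] at he; exact he), fun e he => hemp e _ (by rw [hplan₁₂] at he; exact he),
      fun l hl => hemp l _ hl, fun j' b' hj' hb' _ howned heq => ?_⟩
    exfalso
    have hb0 : b' 0 = 0 := howned ((0 : Fin 4), (0 : K)) (Finset.mem_union_right _ (Finset.mem_insert_self _ _))
    rw [hr₁₂T, hT₁₂] at hj' heq
    rcases Finset.mem_insert.mp hj' with rfl | hj'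
    · exact not_isEquimultiplePoint_W1_bcert r₁₂.1 hr₁₂F hb' heq
    · rw [Finset.mem_singleton] at hj'; subst hj'
      exact not_isEquimultiplePoint_W2_bcert hp3 r₁₂.1 hr₁₂F hb0 heq
  have hblock₁ : BlockA p plan leaves r₁ := by
    refine ⟨fun e he => ?_, fun e he e' he' hne => ?_, fun l hl => hemp l _ hl, fun j' b' hj' hb' hnorm _ heq => ?_⟩
    · -- (P1) for the grandchild's entry
      rw [hplan₁, Finset.mem_singleton] at he
      subst he
      refine ⟨by change (0 : Fin 4) ∈ S₁; rw [hS₁]; decide, rfl, by change (0 : Fin 4) ∈ S₀; rw [hS₀]; decide,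
        Finset.sdiff_subset, fun iv hiv => ?_, isEquimultiplePoint_T0_zero_bcert r₁.1 hr₁F, ?_, fun _ => ⟨fun i _ => rfl, ?_⟩⟩
      · exfalso
        change iv ∈ shiftDefer (0 : Fin 4 → K) S₁ ∅ at hiv
        simp [shiftDefer] at hiv
      · change IsPermissibleCentre p S₀ (CentreBlowup.step p S₁ 0 (0 : Fin 4 → K) r₁.1).F
        rw [step_T0_bcert r₁.1 hr₁F, hS₀]
        exact isPermissibleCentre_U_F00_bcert
      · intro l hl
        change l ∈ S₁ \ S₀ at hl
        rw [hdiff', Finset.mem_singleton] at hl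
        subst hl
        change IsPermissibleCentre p (insert (2 : Fin 4) (S₀.erase 0)) (escState p S₁ 2 (0 : Fin 4 → K) r₁.1).F
        rw [escState_T2_bcert r₁.1 hr₁F, hT₁₂]
        exact isPermissibleCentre_W_F02_bcert
    · -- (P2): one entry only
      rw [hplan₁, Finset.mem_singleton] at he he'
      exact absurd (he.trans he'.symm) hne
    · -- (P5): everything is on the grandchild
      change j' ∈ S₁ at hj'
      rw [hS₁] at hj'
      rcases Finset.mem_insert.mp hj' with rfl | hj'
      · have hb1 := eq_zero_of_isEquimultiplePoint_T0_bcert hp3 r₁.1 hr₁F heq hb'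
        refine Or.inl ⟨e₁, by rw [hplan₁]; exact Finset.mem_singleton_self _, rfl, fun i hi => ?_⟩
        change i ∈ S₀ at hi
        rw [hS₀] at hi
        rcases Finset.mem_insert.mp hi with rfl | hi
        · exact hb'
        · rw [Finset.mem_singleton] at hi; subst hi; exact hb1
      · rw [Finset.mem_singleton] at hj'; subst hj'
        have hb0 : b' 0 = 0 := hnorm 0 (by change (0 : Fin 4) ∈ S₁; rw [hS₁]; decide) (by decide)
        have hb1 := eq_zero_of_isEquimultiplePoint_T2_bcert r₁.1 hr₁F heq hb0
        refine Or.inr (Or.inl ⟨e₁, by rw [hplan₁]; exact Finset.mem_singleton_self _, hesc₁, by change (0 : Fin 4) ≠ 2; decide,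
          by change (2 : Fin 4) ∉ S₀; rw [hS₀]; decide, fun i hi hiS hi0 => ?_, fun i hi hiS => ?_⟩)
        · exfalso
          change i ∈ S₀ at hi; change i ∈ S₁ at hiS
          rw [hS₀] at hi; rw [hS₁] at hiS
          rcases Finset.mem_insert.mp hi with rfl | hi
          · exact hi0 rfl
          · rw [Finset.mem_singleton] at hi; subst hi; exact absurd hiS (by decide)
        · change i ∈ S₀ at hi; change i ∉ S₁ at hiS
          rw [hS₀] at hi; rw [hS₁] at hiS
          rcases Finset.mem_insert.mp hi with rfl | hi
          · exact absurd (by decide) hiS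
          · rw [Finset.mem_singleton] at hi; subst hi; exact hb1
  have hblock₀ : BlockA p plan leaves r₀ := by
    refine ⟨fun e he => ?_, fun e he e' he' hne => ?_, fun l hl => hemp l _ hl, fun j' b' hj' hb' hnorm _ heq => ?_⟩
    · -- (P1) for the child's entry
      rw [hplan₀, Finset.mem_singleton] at he
      subst he
      refine ⟨by change (0 : Fin 4) ∈ S₀; rw [hS₀]; decide, rfl, by change (0 : Fin 4) ∈ S₁; rw [hS₁]; decide,
        fun i hi => hemp i _ hi, fun iv hiv => hemp iv _ hiv, isEquimultiplePoint_S0_zero_bcert s₀ hs₀F, ?_,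
        fun _ => ⟨fun i _ => rfl, ?_⟩⟩
      · change IsPermissibleCentre p S₁ (CentreBlowup.step p S₀ 0 (0 : Fin 4 → K) s₀).F
        rw [step_S0_bcert s₀ hs₀F, hS₁]
        exact isPermissibleCentre_T_F0_bcert
      · intro l hl
        change l ∈ S₀ \ S₁ at hl
        rw [hdiff, Finset.mem_singleton] at hl
        subst hl
        change IsPermissibleCentre p (insert (1 : Fin 4) (S₁.erase 0)) (escState p S₀ 1 (0 : Fin 4 → K) s₀).F
        rw [escState_S1_bcert s₀ hs₀F, hT₂]
        exact isPermissibleCentre_R_F1_bcert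
    · -- (P2): one entry only
      rw [hplan₀, Finset.mem_singleton] at he he'
      exact absurd (he.trans he'.symm) hne
    · -- (P5): everything is on the child
      change j' ∈ S₀ at hj'
      rw [hS₀] at hj'
      rcases Finset.mem_insert.mp hj' with rfl | hj'
      · have hb2 := eq_zero_of_isEquimultiplePoint_S0_bcert s₀ hs₀F heq hb'
        refine Or.inl ⟨e₀, by rw [hplan₀]; exact Finset.mem_singleton_self _, rfl, fun i hi => ?_⟩
        change i ∈ S₁ at hi
        rw [hS₁] at hi
        rcases Finset.mem_insert.mp hi with rfl | hi
        · exact hb'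
        · rw [Finset.mem_singleton] at hi; subst hi; exact hb2
      · rw [Finset.mem_singleton] at hj'; subst hj'
        have hb0 : b' 0 = 0 := hnorm 0 (by change (0 : Fin 4) ∈ S₀; rw [hS₀]; decide) (by decide)
        have hb2 := eq_zero_of_isEquimultiplePoint_S1_bcert hp3 s₀ hs₀F heq hb0 hb'
        refine Or.inr (Or.inl ⟨e₀, by rw [hplan₀]; exact Finset.mem_singleton_self _, hesc₀, by change (0 : Fin 4) ≠ 1; decide,
          by change (1 : Fin 4) ∉ S₁; rw [hS₁]; decide, fun i hi hiS hi0 => ?_, fun i hi hiS => ?_⟩)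
        · exfalso
          change i ∈ S₁ at hi; change i ∈ S₀ at hiS
          rw [hS₁] at hi; rw [hS₀] at hiS
          rcases Finset.mem_insert.mp hi with rfl | hi
          · exact hi0 rfl
          · rw [Finset.mem_singleton] at hi; subst hi; exact absurd hiS (by decide)
        · change i ∈ S₁ at hi; change i ∉ S₀ at hiS
          rw [hS₁] at hi; rw [hS₀] at hiS
          rcases Finset.mem_insert.mp hi with rfl | hi
          · exact absurd (by decide) hiS
          · rw [Finset.mem_singleton] at hi; subst hi; exact hb2
  -- the root
  have hF' : deletePthPowers p (PointBlowup.translate (0 : Fin 4 → K) F) = F := by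
    rw [PointBlowup.translate_zero]
    exact Literature.Barriers.ResolutionOfSingularities.HauserPerlega.deletePthPowers_eq_self (isClean_bcert hp.out.two_le)
  refine exists_isMarkedResolution_atlas_root (p := p) F bcert_ne_zero (isClean_bcert hp.out.two_le) plan leaves 0 S₀ s₀
    (by rw [hF']) isPermissibleCentre_S_bcert (fun q hq => ?_) hacc₀ fun z hz hord i hi => ?_
  · rcases hreach₀ q hq with rfl | rfl | rfl | rfl | rfl
    exacts [hblock₀, hblock₁, hblock₂, hblock₁₁, hblock₁₂]
  · obtain ⟨a, b, hzab⟩ := exists_eq_vanishingIdeal_cons_of_isClosed hz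
    have hord' := (natCast_le_idealOrder_hypSheaf_iff (p := p) F hzab p).mp hord
    rw [natCast_le_ordZero_translate_hyp_iff] at hord'
    obtain ⟨-, H⟩ := hord'
    obtain ⟨hb0, hb1⟩ := roots_bcert b H
    change i ∈ S₀ at hi
    rw [hS₀] at hi
    rcases Finset.mem_insert.mp hi with rfl | hi
    · exact (X_succ_sub_C_mem_asIdeal_iff 0 _ a b hzab).mpr hb0
    · rw [Finset.mem_singleton] at hi; subst hi
      exact (X_succ_sub_C_mem_asIdeal_iff 1 _ a b hzab).mpr hb1

end BCertInstance

end Equimultiple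

end Summit.ResolutionOfSingularities.ResolutionOfSingularities.Theorems.PIDim4

end
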